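import Summits.CriticalPhenomena.PercolationContinuityZ3.Theorems.FK.FreeEdwardsSokalLRO
import Summits.CriticalPhenomena.PercolationContinuityZ3.Theorems.FK.ContinuityTargets
import HarnessLib

/-!
# The `q = 2` transfer: free FK–Ising non-percolation forces wired non-percolation, at every `p`,
# and at `p_c(2)` gives the continuity of the Ising magnetisation — with the LRO hypothesis explicit

fk-continuity build cell, row FO-04 (`--supports stmt-CriticalPhenomena-4575`, helper); builds on p205010
(kernel theorem, internal audit signed; external expert review pending). Sorry-free, standard axioms, no
named facts, no new definitions.

For the FK–Ising random-cluster model (`q = 2`) on `ℤ^d` at `p = 1 - e^{-2β}`: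

* `FK.spontaneousMagnetization_eq_zero_of_thetaFree_eq_zero` — **`θ⁰(p,2) = 0 ⇒ m*(β) = 0`** (`d ≥ 1`,
  `β ≥ 0`): row FO-03a (`FK.lroTildeSq_eq_zero_of_thetaFree_eq_zero`: `θ⁰ = 0 ⇒ M̃_LRO(β) = 0`, Grimmett
  2006 Thm. (5.17) eq. (5.18), free half) followed by ADS15 Thm. 1.2 / §3.2 at `β` WITH ITS LRO
  HYPOTHESIS EXPLICIT (`spontaneousMagnetization_eq_zero_of_lroTildeSq`: `M̃_LRO(β) = 0 ⇒ m*(β) = 0`, the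
  random-current heart `plusPair_eq_freePair_of_lroTildeSq_holds` + FKG + translation invariance) — NOT
  the corollary `spontaneousMagnetization_criticalBeta_eq_zero_holds` that discharges the LRO hypothesis by
  the infrared bound;
* `FK.thetaWired_eq_zero_of_thetaFree_eq_zero`, `FK.thetaFree_eq_zero_iff_thetaWired_eq_zero` —
  **`θ⁰(p,2) = 0 ⇔ θ¹(p,2) = 0` at every `p = 1 - e^{-2β}`** (`θ¹(p,2) = m*(β)`, Grimmett 2006 Thm. (5.17)
  eq. (5.19), `thetaWired_fkIsingParam_two_eq_spontaneousMagnetization`; `θ⁰ ≤ θ¹` always), and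
  `FK.thetaFree_eq_zero_iff_thetaWired_eq_zero_of_lt_one` — the same for every `p ∈ [0,1)`;
* `FK.lroTildeSq_le_thetaWired`, `FK.lroTildeSq_le_spontaneousMagnetization` — the sandwich
  `M̃_LRO(β)² ≤ θ⁰(p,2) ≤ θ¹(p,2) = m*(β)`;
* at the critical point (`d ≥ 2`, `p_c(2) = 1 - e^{-2β_c}`, `rcCriticalProb_two_eq_fkIsingParam_criticalBeta`):
  **`FK.spontaneousMagnetization_criticalBeta_eq_zero_of_thetaFree`** — `θ⁰(p_c(2),2) = 0 ⇒ m*(β_c) = 0`,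
  the shape of a SECOND proof of the continuity of the Ising magnetisation (through ADS15 Thm. 1.2 as
  stated, `spontaneousMagnetization_criticalBeta_eq_zero_of_lroTildeSq_holds`, from a FREE-boundary FK
  input instead of the infrared bound), and **`FK.thetaWired_rcCriticalProb_eq_zero_of_thetaFree`** —
  `θ⁰(p_c(2),2) = 0 ⇒ θ¹(p_c(2),2) = 0`, i.e. the transfer `T_F(d,2) → T_W(d,2)` of SCOPING §3;
* in the vocabulary of the cell's target file (`ContinuityTargets.lean`, row FO-01):
  **`FK.transfer_two : 2 ≤ d → FKTransferAtCritical d 2`** — unconditionally and without Raoufi's fact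
  (compare `transfer_two_of_raoufi`, conditional, and `transfer_two_of_three_le`, which goes through the
  infrared bound) — obtained by discharging the hypothesis `hES` of `wired_two_of_free_two_of_freeES` with
  FO-03a (`FK.lroTildeSq_criticalBeta_eq_zero_of_free_two`), and `FK.wired_two_iff_free_two : 2 ≤ d →
  (FKContinuityWired d 2 ↔ FKContinuityFree d 2)`;
* `FK.thetaFree_eq_zero_iff_thetaWired_eq_zero_of_mem_Icc` — `θ⁰(p,2) = 0 ⇔ θ¹(p,2) = 0` for EVERY
  `p ∈ [0,1]` (at `p = 1` both equal `1`: `thetaFree_one_left`, `thetaWired_one_left`).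

Non-circularity: the constant cones of these theorems contain none of `infraredBound_holds(_all)`,
`lroTildeSq_criticalBeta_eq_zero_holds`, `ads_gaussianDomination_of_infraredBound`,
`spontaneousMagnetization_criticalBeta_eq_zero_holds`, `twoPointPlus_criticalBeta_eq_twoPointFree_holds`,
`criticalTwoPoint_bounds_holds`, `thetaWired_rcCriticalProb_two_eq_zero`,
`thetaFree_rcCriticalProb_two_eq_zero`, `thetaFree_and_thetaWired_rcCriticalProb_two_eq_zero`, nor any
constant from the modules `InfraredBound`, `LroInfraredBound`, `GaussianDomination(Proofs)`,
`ReflectionPositivity`, nor `Raoufi2020_*` (audited with the cell's constant-cone probe `#cone_rp`,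
output filed with the cell; the only token hits are the two self-matches of
`rcCriticalProb_two_eq_fkIsingParam_criticalBeta` on the token `rcCriticalProb_two`, as in SCOPING §3.4).

## References

* G. Grimmett, *The Random-Cluster Model*, Springer 2006: §5.1 (5.1)–(5.3); Thm. (5.16); Thm. (5.17),
  eqs. (5.18)–(5.19). [Grimmett2006]
* M. Aizenman, H. Duminil-Copin, V. Sidoravicius, Comm. Math. Phys. 334 (2015) 719–742, Thm. 1.2,
  §3.2. [AizenmanDuminilCopinSidoraviciusCMP2015]
-/

noncomputable section

namespace Summit.CriticalPhenomena.PercolationContinuityZ3.Theorems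

namespace FK

open Literature.Probability.LatticeModels Literature.Barriers.CriticalPhenomena

variable {d : ℕ}

/-! ### At every `p = 1 - e^{-2β}` -/

/-- **`θ⁰(1 - e^{-2β}, 2) = 0 ⇒ m*(β) = 0`** on `ℤ^d`, `d ≥ 1`, `β ≥ 0`: free FK–Ising non-percolation
forces `M̃_LRO(β) = 0` (FO-03a, Grimmett 2006 (5.18)) and then `m*(β) = 0` by ADS15 Thm. 1.2 / §3.2
at `β` with the LRO hypothesis explicit (`spontaneousMagnetization_eq_zero_of_lroTildeSq`).
[cite: Grimmett2006, Thm. (5.17), eq. (5.18), p. 102 (proof p. 107)] [cite: AizenmanDuminilCopinSidoraviciusCMP2015, Thm. 1.2 and §3.2] -/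
theorem spontaneousMagnetization_eq_zero_of_thetaFree_eq_zero (hd : 1 ≤ d) {β : ℝ} (hβ : 0 ≤ β)
    (h0 : thetaFree d (fkIsingParam β) 2 = 0) : spontaneousMagnetization d β = 0 :=
  spontaneousMagnetization_eq_zero_of_lroTildeSq hβ (lroTildeSq_eq_zero_of_thetaFree_eq_zero hd hβ h0)

/-- **`θ⁰(p,2) = 0 ⇒ θ¹(p,2) = 0` at `p = 1 - e^{-2β}`** (`d ≥ 1`, `β ≥ 0`): `θ¹(p,2) = m*(β)` (Grimmett
2006 Thm. (5.17) eq. (5.19), `thetaWired_fkIsingParam_two_eq_spontaneousMagnetization`) and the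
previous theorem. [cite: Grimmett2006, Thm. (5.17), eqs. (5.18)–(5.19), p. 102] -/
theorem thetaWired_eq_zero_of_thetaFree_eq_zero (hd : 1 ≤ d) {β : ℝ} (hβ : 0 ≤ β)
    (h0 : thetaFree d (fkIsingParam β) 2 = 0) : thetaWired d (fkIsingParam β) 2 = 0 := by
  rw [thetaWired_fkIsingParam_two_eq_spontaneousMagnetization (by omega) hβ]
  exact spontaneousMagnetization_eq_zero_of_thetaFree_eq_zero hd hβ h0

/-- **`θ⁰(p,2) = 0 ⇔ θ¹(p,2) = 0` at every `p = 1 - e^{-2β}`** (`d ≥ 1`, `β ≥ 0`): '⇐' is `0 ≤ θ⁰ ≤ θ¹`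
(`thetaFree_le_thetaWired`). For `q = 2` the free and wired FK–Ising models thus percolate at the same
parameters, without any uniqueness (Raoufi) input. [cite: Grimmett2006, Thm. (5.17), eqs. (5.18)–(5.19), and Thm. (5.16)] -/
theorem thetaFree_eq_zero_iff_thetaWired_eq_zero (hd : 1 ≤ d) {β : ℝ} (hβ : 0 ≤ β) :
    thetaFree d (fkIsingParam β) 2 = 0 ↔ thetaWired d (fkIsingParam β) 2 = 0 :=
  ⟨thetaWired_eq_zero_of_thetaFree_eq_zero hd hβ, fun h1 =>
    le_antisymm ((thetaFree_le_thetaWired (fkIsingParam_mem_Icc hβ) (by norm_num)).trans h1.le)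
      (thetaFree_nonneg _ _)⟩

/-- The same for every `p ∈ [0,1)` (through `β(p) = -log(1-p)/2 ≥ 0`, `1 - e^{-2β(p)} = p`):
`θ⁰(p,2) = 0 ⇔ θ¹(p,2) = 0` on `ℤ^d`, `d ≥ 1`. [cite: Grimmett2006, Thm. (5.17), eqs. (5.18)–(5.19), p. 102] -/
theorem thetaFree_eq_zero_iff_thetaWired_eq_zero_of_lt_one (hd : 1 ≤ d) {p : ℝ} (hp0 : 0 ≤ p)
    (hp1 : p < 1) : thetaFree d p 2 = 0 ↔ thetaWired d p 2 = 0 := by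
  rw [← fkIsingParam_neg_log_div_two hp1]
  exact thetaFree_eq_zero_iff_thetaWired_eq_zero hd (neg_log_div_two_nonneg hp0 hp1)

/-- **The sandwich `M̃_LRO(β)² ≤ θ¹(1 - e^{-2β}, 2)`** (`d ≥ 1`, `β ≥ 0`): `M̃_LRO² ≤ θ⁰ ≤ θ¹`.
[cite: Grimmett2006, Thm. (5.17), eq. (5.18), and Lemma (4.14)(b)] -/
theorem lroTildeSq_le_thetaWired (hd : 1 ≤ d) {β : ℝ} (hβ : 0 ≤ β) :
    lroTildeSq d β ≤ thetaWired d (fkIsingParam β) 2 :=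
  (lroTildeSq_le_thetaFree hd hβ).trans (thetaFree_le_thetaWired (fkIsingParam_mem_Icc hβ) (by norm_num))

/-- **`M̃_LRO(β)² ≤ m*(β)`** (`d ≥ 1`, `β ≥ 0`): `M̃_LRO² ≤ θ⁰ ≤ θ¹ = m*` (Grimmett 2006 (5.18)–(5.19);
compare ADS15 Prop. 1.1, `M_LRO ≤ m*`). [cite: Grimmett2006, Thm. (5.17), eqs. (5.18)–(5.19), p. 102] [cite: AizenmanDuminilCopinSidoraviciusCMP2015, Prop. 1.1] -/
theorem lroTildeSq_le_spontaneousMagnetization (hd : 1 ≤ d) {β : ℝ} (hβ : 0 ≤ β) :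
    lroTildeSq d β ≤ spontaneousMagnetization d β := by
  rw [← thetaWired_fkIsingParam_two_eq_spontaneousMagnetization (by omega) hβ]
  exact lroTildeSq_le_thetaWired hd hβ

/-! ### At the critical point `p_c(2) = 1 - e^{-2β_c}`, `d ≥ 2` -/

/-- **`θ⁰(p_c(2), 2) = 0 ⇒ m*(β_c) = 0` on `ℤ^d`, `d ≥ 2`** — the shape of a second proof of the
continuity of the Ising magnetisation: if the FREE FK–Ising model does not percolate at its critical
point, then `M̃_LRO(β_c) = 0` (FO-03a with `p_c(2) = 1 - e^{-2β_c}`,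
`rcCriticalProb_two_eq_fkIsingParam_criticalBeta`) and ADS15 Thm. 1.2 AS STATED
(`spontaneousMagnetization_criticalBeta_eq_zero_of_lroTildeSq_holds`: `M̃_LRO(β_c) = 0 ⇒ m*(β_c) = 0`,
proved in the tree from random currents, no reflection positivity) give `m*(β_c) = 0`. The infrared
bound enters NOWHERE (it is what ADS15 §3.3 use to get `M̃_LRO(β_c) = 0`; here that input is replaced
by the free FK hypothesis). [cite: AizenmanDuminilCopinSidoraviciusCMP2015, Thm. 1.2] [cite: Grimmett2006, Thm. (5.17), eq. (5.18), and (5.2)] -/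
theorem spontaneousMagnetization_criticalBeta_eq_zero_of_thetaFree (hd : 2 ≤ d)
    (h0 : thetaFree d (rcCriticalProb d 2) 2 = 0) : spontaneousMagnetization d (criticalBeta d) = 0 := by
  rw [rcCriticalProb_two_eq_fkIsingParam_criticalBeta hd] at h0
  exact spontaneousMagnetization_criticalBeta_eq_zero_of_lroTildeSq_holds hd
    (lroTildeSq_eq_zero_of_thetaFree_eq_zero (by omega) (criticalBeta_nonneg d) h0)

/-- **The `q = 2` transfer at criticality, `T_F(d,2) → T_W(d,2)`**: on `ℤ^d`, `d ≥ 2`,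
`θ⁰(p_c(2), 2) = 0 ⇒ θ¹(p_c(2), 2) = 0` — unconditionally (no Raoufi fact, no infrared bound): the
previous theorem and `θ¹(1 - e^{-2β_c}, 2) = m*(β_c)` (Grimmett 2006 (5.19)). This is
`FKTransferAtCritical d 2` of the cell's target file (row FO-01), stated over tree declarations.
[cite: Grimmett2006, Thm. (5.17), eqs. (5.18)–(5.19), and (5.2)] [cite: AizenmanDuminilCopinSidoraviciusCMP2015, Thm. 1.2] -/
theorem thetaWired_rcCriticalProb_eq_zero_of_thetaFree (hd : 2 ≤ d)
    (h0 : thetaFree d (rcCriticalProb d 2) 2 = 0) : thetaWired d (rcCriticalProb d 2) 2 = 0 := by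
  rw [rcCriticalProb_two_eq_fkIsingParam_criticalBeta hd] at h0 ⊢
  exact thetaWired_eq_zero_of_thetaFree_eq_zero (by omega) (criticalBeta_nonneg d) h0

/-- **At criticality the two phases vanish together**: `θ⁰(p_c(2),2) = 0 ⇔ θ¹(p_c(2),2) = 0` on `ℤ^d`,
`d ≥ 2` (unconditional; for `d ≥ 3` both sides are known to hold, by ADS15 Cor. 1.5(1) through the
infrared bound — not used here). [cite: Grimmett2006, Thm. (5.17), eqs. (5.18)–(5.19), and Thm. (5.16)] -/
theorem thetaFree_rcCriticalProb_eq_zero_iff_thetaWired (hd : 2 ≤ d) :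
    thetaFree d (rcCriticalProb d 2) 2 = 0 ↔ thetaWired d (rcCriticalProb d 2) 2 = 0 := by
  rw [rcCriticalProb_two_eq_fkIsingParam_criticalBeta hd]
  exact thetaFree_eq_zero_iff_thetaWired_eq_zero (by omega) (criticalBeta_nonneg d)

/-- **`m*(β_c) = 0 ⇔ θ⁰(p_c(2), 2) = 0`** on `ℤ^d`, `d ≥ 2`: continuity of the Ising magnetisation at
`β_c` is EQUIVALENT to non-percolation of the free FK–Ising model at `p_c(2)` (`θ¹ = m*` and the
previous equivalence). [cite: Grimmett2006, Thm. (5.17), eqs. (5.18)–(5.19), p. 102] [cite: AizenmanDuminilCopinSidoraviciusCMP2015, Thm. 1.2] -/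
theorem spontaneousMagnetization_criticalBeta_eq_zero_iff_thetaFree (hd : 2 ≤ d) :
    spontaneousMagnetization d (criticalBeta d) = 0 ↔ thetaFree d (rcCriticalProb d 2) 2 = 0 := by
  rw [thetaFree_rcCriticalProb_eq_zero_iff_thetaWired hd, rcCriticalProb_two_eq_fkIsingParam_criticalBeta hd,
    thetaWired_fkIsingParam_two_eq_spontaneousMagnetization (by omega) (criticalBeta_nonneg d)]

/-! ### In the vocabulary of the target file (row FO-01) -/

/-- **FO-03a at the critical point, in the target vocabulary**: T_F(d,2) (`FKContinuityFree d 2`, i.e.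
`θ⁰(p_c(2),2) = 0`) gives ADS15's hypothesis `M̃_LRO(β_c)² = 0` (`d ≥ 2`; `p_c(2) = 1 - e^{-2β_c}`). This is
the hypothesis `hES` of `wired_two_of_free_two_of_freeES` (`ContinuityTargets.lean`), discharged.
[cite: Grimmett2006, Thm. (5.17), eq. (5.18), p. 102 (proof p. 107)] [cite: AizenmanDuminilCopinSidoraviciusCMP2015, Thm. 1.2 (hypothesis (1.12))] -/
theorem lroTildeSq_criticalBeta_eq_zero_of_free_two (hd : 2 ≤ d) (hF : FKContinuityFree d 2) :
    lroTildeSq d (criticalBeta d) = 0 := by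
  have h0 : thetaFree d (rcCriticalProb d 2) 2 = 0 := hF
  rw [rcCriticalProb_two_eq_fkIsingParam_criticalBeta hd] at h0
  exact lroTildeSq_eq_zero_of_thetaFree_eq_zero (by omega) (criticalBeta_nonneg d) h0

/-- **T_U(d,2) — the `q = 2` transfer at criticality holds unconditionally on `ℤ^d`, `d ≥ 2`**:
`FKTransferAtCritical d 2`, i.e. `θ⁰(p_c(2),2) = 0 → θ¹(p_c(2),2) = 0`, by the cell's assembled second-proof
chain `wired_two_of_free_two_of_freeES` (ADS15 Thm. 1.2 first assertion as proved in the tree + the wired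
Edwards–Sokal dictionary) with its free Edwards–Sokal hypothesis discharged by FO-03a. No Raoufi fact (compare
`transfer_two_of_raoufi`), no infrared bound (compare `transfer_two_of_three_le`).
[cite: Grimmett2006, Thm. (5.16)(c) and Thm. (5.17), eqs. (5.18)–(5.19)] [cite: AizenmanDuminilCopinSidoraviciusCMP2015, Thm. 1.2 (first assertion)] -/
theorem transfer_two (hd : 2 ≤ d) : FKTransferAtCritical d 2 :=
  fun hF => wired_two_of_free_two_of_freeES hd hF (lroTildeSq_criticalBeta_eq_zero_of_free_two hd)

/-- **T_W(d,2) ⇔ T_F(d,2)** on `ℤ^d`, `d ≥ 2`: the wired and free `q = 2` continuity targets are EQUIVALENT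
(`free_of_wired` is the comparison of boundary conditions; `transfer_two` the converse).
[cite: Grimmett2006, Thm. (5.16) and Thm. (5.17), eqs. (5.18)–(5.19)] -/
theorem wired_two_iff_free_two (hd : 2 ≤ d) : FKContinuityWired d 2 ↔ FKContinuityFree d 2 :=
  ⟨free_of_wired (by norm_num), transfer_two hd⟩

/-- **Ising continuity at `β_c` ⇔ T_F(d,2)** (`d ≥ 2`): `m*(β_c(d)) = 0 ↔ θ⁰(p_c(2),2) = 0`, in the target
vocabulary (`wired_two_iff_ising_continuity` of the target file composed with `wired_two_iff_free_two`).
[cite: Grimmett2006, Thm. (5.17), eqs. (5.18)–(5.19), p. 102] [cite: AizenmanDuminilCopinSidoraviciusCMP2015, Thm. 1.2] -/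
theorem free_two_iff_ising_continuity (hd : 2 ≤ d) :
    FKContinuityFree d 2 ↔ spontaneousMagnetization d (criticalBeta d) = 0 :=
  (spontaneousMagnetization_criticalBeta_eq_zero_iff_thetaFree hd).symm

/-- **`θ⁰(p,2) = 0 ⇔ θ¹(p,2) = 0` for EVERY `p ∈ [0,1]`** on `ℤ^d`, `d ≥ 1`: for `p < 1` this is
`thetaFree_eq_zero_iff_thetaWired_eq_zero_of_lt_one`; at `p = 1` both sides are false
(`θ⁰(1,q) = θ¹(1,q) = 1`, `thetaFree_one_left` / `thetaWired_one_left`). For FK–Ising the free and wired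
percolation thresholds — and the behaviour AT the threshold — coincide, with no uniqueness input.
[cite: Grimmett2006, Thm. (5.16)(c) and Thm. (5.17), eqs. (5.18)–(5.19)] -/
theorem thetaFree_eq_zero_iff_thetaWired_eq_zero_of_mem_Icc (hd : 1 ≤ d) {p : ℝ}
    (hp : p ∈ Set.Icc (0 : ℝ) 1) : thetaFree d p 2 = 0 ↔ thetaWired d p 2 = 0 := by
  rcases hp.2.lt_or_eq with hp1 | rfl
  · exact thetaFree_eq_zero_iff_thetaWired_eq_zero_of_lt_one hd hp.1 hp1
  · rw [thetaFree_one_left (by omega) two_pos, thetaWired_one_left (by omega) two_pos]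

/-! ### Row FO-03b (converse direction) and the packaged equivalences at every `β`

Grimmett 2006, Thm. (5.17) eq. (5.18) at `q = 2` reads `½ θ⁰(p,2)² = lim_{|u|→∞} {π_{β}(σ_0 = σ_u) - ½}`,
i.e. `⟨σ_0σ_u⟩^∅_β → θ⁰(p,2)²`; its proof (p. 107, (5.32)) uses the infinite-volume free measure `φ⁰_{p,2}`,
the uniqueness of its infinite cluster, mixing and FKG. For the ZERO FORM that the cell's row FO-03 asks
for — `θ⁰(1 - e^{-2β}, 2) = 0 ⟺ M̃_LRO(β) = 0` — that machinery is by-passed: the '⇒' half is row FO-03a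
(finite volume only) and the '⇐' half follows from ADS15 Thm. 1.2 / §3.2 at `β` as proved in the tree
(`spontaneousMagnetization_eq_zero_of_lroTildeSq`: `M̃_LRO(β) = 0 ⇒ m*(β) = 0`, random currents) with
`m*(β) = θ¹(p,2) ≥ θ⁰(p,2)` (Grimmett 2006 (5.19) and Lemma (4.14)(b)). Together with the tree's dichotomy
`m*(β) = 0 ⟺ ⟨σ_0σ_x⟩^∅_β → 0` (`spontaneousMagnetization_eq_zero_iff_twoPointFree_tendsto_zero`) the five
order parameters `θ⁰(p,2)`, `θ¹(p,2)`, `m*(β)`, `M̃_LRO(β)`, `limsup ⟨σ_0σ_x⟩^∅_β` vanish together at every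
`β ≥ 0` (`FK.fkIsing_orderParameters_tfae`). -/

section Equivalences

open Filter Topology

/-- **FO-03b, the converse direction: `M̃_LRO(β) = 0 ⇒ θ⁰(1 - e^{-2β}, 2) = 0`** on `ℤ^d`, `d ≥ 1`,
`β ≥ 0`: `M̃_LRO(β) = 0 ⇒ m*(β) = 0` (ADS15 Thm. 1.2 / §3.2 at `β`, as proved in the tree from random
currents, `spontaneousMagnetization_eq_zero_of_lroTildeSq`), `m*(β) = θ¹(p,2)` (Grimmett 2006 (5.19),
`thetaWired_fkIsingParam_two_eq_spontaneousMagnetization`) and `0 ≤ θ⁰ ≤ θ¹` (`thetaFree_le_thetaWired`).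
Grimmett's own route to this half of (5.18) — uniqueness of the infinite `φ⁰`-cluster, mixing and FKG in
infinite volume (proof of (5.32), p. 107) — is not needed for the zero form at `q = 2`.
[cite: AizenmanDuminilCopinSidoraviciusCMP2015, Thm. 1.2 and §3.2] [cite: Grimmett2006, Thm. (5.17), eqs. (5.18)–(5.19), p. 102, and Lemma (4.14)(b)] -/
theorem thetaFree_eq_zero_of_lroTildeSq_eq_zero (hd : 1 ≤ d) {β : ℝ} (hβ : 0 ≤ β)
    (h0 : lroTildeSq d β = 0) : thetaFree d (fkIsingParam β) 2 = 0 := by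
  refine le_antisymm ?_ (thetaFree_nonneg _ _)
  calc thetaFree d (fkIsingParam β) 2 ≤ thetaWired d (fkIsingParam β) 2 :=
        thetaFree_le_thetaWired (fkIsingParam_mem_Icc hβ) (by norm_num)
    _ = spontaneousMagnetization d β :=
        thetaWired_fkIsingParam_two_eq_spontaneousMagnetization (by omega) hβ
    _ = 0 := spontaneousMagnetization_eq_zero_of_lroTildeSq hβ h0

/-- **Row FO-03 packaged: `θ⁰(1 - e^{-2β}, 2) = 0 ⟺ M̃_LRO(β)² = 0`** on `ℤ^d`, `d ≥ 1`, `β ≥ 0` — the zero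
form of Grimmett 2006 Thm. (5.17) eq. (5.18) at `q = 2` (free FK–Ising percolation probability versus
ADS15's variant long-range order parameter of the free Ising state): '⇒' is FO-03a
(`lroTildeSq_eq_zero_of_thetaFree_eq_zero`, finite-volume Edwards–Sokal + Cesàro), '⇐' is FO-03b
(`thetaFree_eq_zero_of_lroTildeSq_eq_zero`, through ADS15 Thm. 1.2 at `β` and (5.19)).
[cite: Grimmett2006, Thm. (5.17), eq. (5.18), p. 102] [cite: AizenmanDuminilCopinSidoraviciusCMP2015, Thm. 1.2 and §1.3 eqs. (1.9)–(1.10)] -/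
theorem thetaFree_eq_zero_iff_lroTildeSq_eq_zero (hd : 1 ≤ d) {β : ℝ} (hβ : 0 ≤ β) :
    thetaFree d (fkIsingParam β) 2 = 0 ↔ lroTildeSq d β = 0 :=
  ⟨lroTildeSq_eq_zero_of_thetaFree_eq_zero hd hβ, thetaFree_eq_zero_of_lroTildeSq_eq_zero hd hβ⟩

/-- **`M̃_LRO(β)² = 0 ⟺ m*(β) = 0`** on `ℤ^d`, `d ≥ 1`, `β ≥ 0`: '⇒' is ADS15 Thm. 1.2 / §3.2 at `β`
(`spontaneousMagnetization_eq_zero_of_lroTildeSq`); '⇐' is the sandwich `0 ≤ M̃_LRO(β)² ≤ θ⁰ ≤ θ¹ = m*(β)`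
(`lroTildeSq_nonneg`, `lroTildeSq_le_spontaneousMagnetization`; compare ADS15 Prop. 1.1, `M_LRO ≤ m*`).
[cite: AizenmanDuminilCopinSidoraviciusCMP2015, Thm. 1.2, §3.2 and Prop. 1.1] [cite: Grimmett2006, Thm. (5.17), eqs. (5.18)–(5.19), p. 102] -/
theorem lroTildeSq_eq_zero_iff_spontaneousMagnetization_eq_zero (hd : 1 ≤ d) {β : ℝ} (hβ : 0 ≤ β) :
    lroTildeSq d β = 0 ↔ spontaneousMagnetization d β = 0 :=
  ⟨spontaneousMagnetization_eq_zero_of_lroTildeSq hβ, fun hm =>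
    le_antisymm (hm ▸ lroTildeSq_le_spontaneousMagnetization hd hβ) (lroTildeSq_nonneg hβ)⟩

/-- **`θ⁰(1 - e^{-2β}, 2) = 0 ⟺ m*(β) = 0`** on `ℤ^d`, `d ≥ 1`, `β ≥ 0`: `θ⁰ = 0 ⟺ θ¹ = 0`
(`thetaFree_eq_zero_iff_thetaWired_eq_zero`) and `θ¹(p,2) = m*(β)` (Grimmett 2006 (5.19)).
[cite: Grimmett2006, Thm. (5.17), eqs. (5.18)–(5.19), p. 102] [cite: AizenmanDuminilCopinSidoraviciusCMP2015, Thm. 1.2 and §3.2] -/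
theorem thetaFree_eq_zero_iff_spontaneousMagnetization_eq_zero (hd : 1 ≤ d) {β : ℝ} (hβ : 0 ≤ β) :
    thetaFree d (fkIsingParam β) 2 = 0 ↔ spontaneousMagnetization d β = 0 := by
  rw [thetaFree_eq_zero_iff_thetaWired_eq_zero hd hβ,
    thetaWired_fkIsingParam_two_eq_spontaneousMagnetization (by omega) hβ]

/-- **Grimmett's (5.18) at `q = 2` in zero form: `θ⁰(1 - e^{-2β}, 2) = 0 ⟺ ⟨σ_0σ_x⟩^∅_{β,0} → 0`**
(`x → ∞` in `ℤ^d`, `d ≥ 1`, `β ≥ 0`; by Edwards–Sokal `π_β(σ_0 = σ_x) - ½ = ½ ⟨σ_0σ_x⟩^∅_β`, so this is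
`θ⁰(p,2) = 0 ⟺ lim {π_β(σ_0 = σ_x) - ½} = 0`): '⇒' is FO-03a
(`twoPointFree_tendsto_zero_of_thetaFree_eq_zero`); '⇐' is the Cesàro step
`lroTildeSq_eq_zero_of_twoPointFree_tendsto_zero` (ADS15 §1.3 (1.10)) followed by FO-03b.
[cite: Grimmett2006, Thm. (5.17), eq. (5.18), p. 102 (proof p. 107, (5.32))] [cite: AizenmanDuminilCopinSidoraviciusCMP2015, §1.3 eq. (1.10) and Thm. 1.2] -/
theorem thetaFree_eq_zero_iff_twoPointFree_tendsto_zero (hd : 1 ≤ d) {β : ℝ} (hβ : 0 ≤ β) :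
    thetaFree d (fkIsingParam β) 2 = 0 ↔ Tendsto (twoPointFree d β) cofinite (𝓝 0) :=
  ⟨twoPointFree_tendsto_zero_of_thetaFree_eq_zero hβ, fun h =>
    thetaFree_eq_zero_of_lroTildeSq_eq_zero hd hβ
      (lroTildeSq_eq_zero_of_twoPointFree_tendsto_zero hd hβ h)⟩

/-- **The five order parameters of the FK–Ising / Ising model vanish together** on `ℤ^d`, `d ≥ 1`, at
every `β ≥ 0`, `p = 1 - e^{-2β}`: the following are equivalent — (1) `θ⁰(p,2) = 0` (free FK–Ising does not
percolate); (2) `θ¹(p,2) = 0` (wired FK–Ising does not percolate); (3) `m*(β) = 0` (no spontaneous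
magnetisation); (4) `M̃_LRO(β)² = 0` (no long-range order in the free state, ADS15 §1.3); (5)
`⟨σ_0σ_x⟩^∅_{β,0} → 0` as `x → ∞`. (Grimmett 2006 Thm. (5.16)–(5.17), eqs. (5.18)–(5.19); ADS15 Thm. 1.2,
§3.2, Prop. 1.1 and §1.3; the Lebowitz–Martin-Löf / plus-state clustering dichotomy
`spontaneousMagnetization_eq_zero_iff_twoPointFree_tendsto_zero`.) No uniqueness-of-Gibbs-measure or
reflection-positivity input. [cite: Grimmett2006, Thm. (5.17), eqs. (5.18)–(5.19), p. 102] [cite: AizenmanDuminilCopinSidoraviciusCMP2015, Thm. 1.2, §3.2, Prop. 1.1 and §1.3] -/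
theorem fkIsing_orderParameters_tfae (hd : 1 ≤ d) {β : ℝ} (hβ : 0 ≤ β) :
    List.TFAE [thetaFree d (fkIsingParam β) 2 = 0, thetaWired d (fkIsingParam β) 2 = 0,
      spontaneousMagnetization d β = 0, lroTildeSq d β = 0,
      Tendsto (twoPointFree d β) cofinite (𝓝 0)] := by
  tfae_have 1 ↔ 2 := thetaFree_eq_zero_iff_thetaWired_eq_zero hd hβ
  tfae_have 1 ↔ 3 := thetaFree_eq_zero_iff_spontaneousMagnetization_eq_zero hd hβ
  tfae_have 1 ↔ 4 := thetaFree_eq_zero_iff_lroTildeSq_eq_zero hd hβ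
  tfae_have 1 ↔ 5 := thetaFree_eq_zero_iff_twoPointFree_tendsto_zero hd hβ
  tfae_finish

/-- The packaged equivalence for every `p ∈ [0,1)` (through `β(p) = -log(1-p)/2 ≥ 0`,
`1 - e^{-2β(p)} = p`): `θ⁰(p,2) = 0 ⟺ M̃_LRO(β(p))² = 0` on `ℤ^d`, `d ≥ 1`.
[cite: Grimmett2006, Thm. (5.17), eq. (5.18), p. 102] [cite: AizenmanDuminilCopinSidoraviciusCMP2015, Thm. 1.2] -/
theorem thetaFree_eq_zero_iff_lroTildeSq_eq_zero_of_lt_one (hd : 1 ≤ d) {p : ℝ} (hp0 : 0 ≤ p)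
    (hp1 : p < 1) : thetaFree d p 2 = 0 ↔ lroTildeSq d (-Real.log (1 - p) / 2) = 0 := by
  have h := thetaFree_eq_zero_iff_lroTildeSq_eq_zero hd (neg_log_div_two_nonneg hp0 hp1)
  rwa [fkIsingParam_neg_log_div_two hp1] at h

/-! #### At the critical point `p_c(2) = 1 - e^{-2β_c}`, `d ≥ 2` -/

/-- **T_F(d,2) ⟺ `M̃_LRO(β_c)² = 0`** on `ℤ^d`, `d ≥ 2`: non-percolation of the FREE FK–Ising model at
`p_c(2)` (`FKContinuityFree d 2`) is EQUIVALENT to ADS15's hypothesis (1.12) at `β_c` — so the free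
`q = 2` continuity target of the cell is exactly as hard as establishing `M̃_LRO(β_c) = 0` without the
infrared bound (ADS15 §3.3 obtain it from the infrared bound for `d ≥ 3`; not used here).
[cite: AizenmanDuminilCopinSidoraviciusCMP2015, Thm. 1.2 (hypothesis (1.12)) and §3.3] [cite: Grimmett2006, Thm. (5.17), eq. (5.18), and (5.2)] -/
theorem free_two_iff_lroTildeSq_criticalBeta_eq_zero (hd : 2 ≤ d) :
    FKContinuityFree d 2 ↔ lroTildeSq d (criticalBeta d) = 0 :=
  (free_two_iff_ising_continuity hd).trans
    (lroTildeSq_eq_zero_iff_spontaneousMagnetization_eq_zero (by omega) (criticalBeta_nonneg d)).symm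

/-- The same over tree declarations: `θ⁰(p_c(2), 2) = 0 ⟺ M̃_LRO(β_c)² = 0` on `ℤ^d`, `d ≥ 2`
(`p_c(2) = 1 - e^{-2β_c}`, `rcCriticalProb_two_eq_fkIsingParam_criticalBeta`).
[cite: Grimmett2006, Thm. (5.17), eq. (5.18), and (5.2)] [cite: AizenmanDuminilCopinSidoraviciusCMP2015, Thm. 1.2 (hypothesis (1.12))] -/
theorem thetaFree_rcCriticalProb_eq_zero_iff_lroTildeSq (hd : 2 ≤ d) :
    thetaFree d (rcCriticalProb d 2) 2 = 0 ↔ lroTildeSq d (criticalBeta d) = 0 := by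
  rw [rcCriticalProb_two_eq_fkIsingParam_criticalBeta hd]
  exact thetaFree_eq_zero_iff_lroTildeSq_eq_zero (by omega) (criticalBeta_nonneg d)

end Equivalences

end FK

end Summit.CriticalPhenomena.PercolationContinuityZ3.Theorems

end
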